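import Mathlib
import Summits.Ventures.PercRepro2.Defs
import Summits.Ventures.PercRepro2.Independence
import Summits.Ventures.PercRepro2.Harris
import Summits.Ventures.PercRepro2.Graph
import Summits.Ventures.PercRepro2.Events
import Summits.Ventures.PercRepro2.BHKEvents
import Summits.Ventures.PercRepro2.BHKAvoidWeighted
import Summits.Ventures.PercRepro2.BasePendant

/-!
# Pendant vertices and the (Ψ) inequality, I: transfer lemmas (PercRepro2, p2)

Auxiliary lemmas for `PsiPendant.lean` / `PsiPendantCond.lean` (P2-G17-PSI.md §3): probabilities
under the weight vectors `p[f↦1]` / `p[f↦0]` (the pendant edge `f` pinned open / closed, on the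
same configuration space, `prob_eq_pin`) — transfer between corresponding events, invariance of
`f`-free events, monotonicity, and the `p f`-factor of events inside `{f open}`; the connection
facts for a leaf (on `BasePendant.lean`'s `conn_update_leaf_iff` / `conn_leaf_open` /
`conn_leaf_closed`); and the three pieces of pure algebra of the reductions.
-/

namespace Summit.Ventures.PercRepro2

section PendantTransfer

variable {V : Type*} {E : Type*} [Fintype E] [DecidableEq E] {R : Type*} [CommRing R]

/-- Pinned-open and pinned-closed probabilities agree on events that correspond under forcing the
edge (`P_{p[f↦1]}(A) = P_{p[f↦0]}(A')` when `ω[f↦1] ∈ A ↔ ω[f↦0] ∈ A'` for every `ω`). -/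
lemma prob_update_one_eq_prob_update_zero (p : E → R) (f : E) {A A' : Set (Config E)}
    (h : ∀ ω : Config E, Function.update ω f true ∈ A ↔ Function.update ω f false ∈ A') :
    prob (Function.update p f 1) A = prob (Function.update p f 0) A' := by
  rw [prob_eq_expect_indicator, prob_eq_expect_indicator, expect_update_one, expect_update_zero]
  unfold expect
  refine Finset.sum_congr rfl fun ω _ => ?_
  congr 1
  by_cases hω : Function.update ω f true ∈ A
  · have h' := (h ω).1 hω
    simp [hω, h']
  · have h' : Function.update ω f false ∉ A' := fun h' => hω ((h ω).2 h')
    simp [hω, h']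

/-- An event invariant under forcing `f` open has the same probability with `f` pinned open. -/
lemma prob_update_one_of_invariant (p : E → R) (f : E) {A : Set (Config E)}
    (h : ∀ ω : Config E, Function.update ω f true ∈ A ↔ ω ∈ A) :
    prob (Function.update p f 1) A = prob p A := by
  rw [prob_eq_expect_indicator, prob_eq_expect_indicator, expect_update_one]
  unfold expect
  refine Finset.sum_congr rfl fun ω _ => ?_
  congr 1
  by_cases hω : ω ∈ A
  · have h' := (h ω).2 hω
    simp [hω, h']
  · have h' : Function.update ω f true ∉ A := fun h' => hω ((h ω).1 h')
    simp [hω, h']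

/-- An event invariant under forcing `f` closed has the same probability with `f` pinned closed. -/
lemma prob_update_zero_of_invariant (p : E → R) (f : E) {A : Set (Config E)}
    (h : ∀ ω : Config E, Function.update ω f false ∈ A ↔ ω ∈ A) :
    prob (Function.update p f 0) A = prob p A := by
  rw [prob_eq_expect_indicator, prob_eq_expect_indicator, expect_update_zero]
  unfold expect
  refine Finset.sum_congr rfl fun ω _ => ?_
  congr 1
  by_cases hω : ω ∈ A
  · have h' := (h ω).2 hω
    simp [hω, h']
  · have h' : Function.update ω f false ∉ A := fun h' => hω ((h ω).1 h')
    simp [hω, h']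

/-- An event contained in `{f open}` has probability `p f` times its pinned-open probability. -/
lemma prob_eq_mul_prob_update_one_of_subset (p : E → R) (f : E) {A : Set (Config E)}
    (h : A ⊆ openEdge f) : prob p A = p f * prob (Function.update p f 1) A := by
  rw [← prob_inter_openEdge, Set.inter_eq_left.2 h]

end PendantTransfer

section PendantMono

variable {V : Type*} {E : Type*} [Fintype E] [DecidableEq E] {R : Type*} [CommRing R]
  [PartialOrder R] [IsOrderedRing R]

/-- Pinned-closed probability is at most the pinned-open probability of an event that can only
be entered by opening `f`. -/
lemma prob_update_zero_le_prob_update_one {p : E → R} (hp : IsProbVec p) (f : E)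
    {A : Set (Config E)}
    (h : ∀ ω : Config E, Function.update ω f false ∈ A → Function.update ω f true ∈ A) :
    prob (Function.update p f 0) A ≤ prob (Function.update p f 1) A := by
  rw [prob_eq_expect_indicator, prob_eq_expect_indicator, expect_update_one, expect_update_zero]
  refine expect_mono hp fun ω => ?_
  by_cases hω : Function.update ω f false ∈ A
  · simp [hω, h ω hω]
  · rw [Set.indicator_of_notMem hω]
    exact Set.indicator_apply_nonneg fun _ => zero_le_one

end PendantMono

section LeafFacts

variable {V : Type*} {E : Type*}

/-- A vertex other than the leaf connected to the leaf forces the leaf edge open. -/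
lemma mem_openEdge_of_conn_leaf {ends : E → Sym2 V} {ω : Config E} {v y : V} {f : E}
    (hf : ends f = s(v, y)) (hleaf : ∀ e, v ∈ ends e → e = f) (hvy : v ≠ y) {x : V}
    (hx : x ≠ v) (h : Conn ends ω x v) : ω ∈ openEdge f := by
  by_contra hc
  have hωf : ω f = false := by simpa using hc
  exact hx (conn_leaf_closed hf hleaf hvy hωf (conn_symm h))

/-- With the leaf edge open, connections to the leaf are connections to its neighbour. -/
lemma conn_to_leaf_iff {ends : E → Sym2 V} {ω : Config E} {v y : V} {f : E}
    (hf : ends f = s(v, y)) (hωf : ω f = true) {x : V} :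
    Conn ends ω x v ↔ Conn ends ω x y := by
  constructor
  · intro h; exact conn_symm ((conn_leaf_open hf hωf).1 (conn_symm h))
  · intro h; exact conn_symm ((conn_leaf_open hf hωf).2 (conn_symm h))

variable [DecidableEq E]

/-- Connections among non-leaf vertices agree after forcing the leaf edge open or closed. -/
lemma conn_update_true_iff_update_false {ends : E → Sym2 V} {ω : Config E} {v y : V} {f : E}
    (hf : ends f = s(v, y)) (hleaf : ∀ e, v ∈ ends e → e = f) (hvy : v ≠ y) {x z : V}
    (hx : x ≠ v) (hz : z ≠ v) :
    Conn ends (Function.update ω f true) x z ↔ Conn ends (Function.update ω f false) x z := by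
  rw [conn_update_leaf_iff hf hleaf hvy true hx hz, conn_update_leaf_iff hf hleaf hvy false hx hz]

/-- Connection of a non-leaf vertex to the leaf with `f` forced open is connection to the
neighbour with `f` forced closed. -/
lemma conn_update_true_leaf_iff {ends : E → Sym2 V} {ω : Config E} {v y : V} {f : E}
    (hf : ends f = s(v, y)) (hleaf : ∀ e, v ∈ ends e → e = f) (hvy : v ≠ y) {x : V}
    (hx : x ≠ v) :
    Conn ends (Function.update ω f true) x v ↔ Conn ends (Function.update ω f false) x y := by
  rw [conn_to_leaf_iff hf (by simp), conn_update_true_iff_update_false hf hleaf hvy hx hvy.symm]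

/-- If the neighbour of the leaf is not in `C_s` (`f` forced open), the cluster of `s` is the
same with `f` forced open or closed. -/
lemma cluster_update_true_eq_update_false {ends : E → Sym2 V} {ω : Config E} {v y : V} {f : E}
    (hf : ends f = s(v, y)) (hleaf : ∀ e, v ∈ ends e → e = f) (hvy : v ≠ y) {s : V}
    (hs : s ≠ v) (hsy : ¬ Conn ends (Function.update ω f true) s y) :
    cluster ends (Function.update ω f true) s = cluster ends (Function.update ω f false) s := by
  ext x
  simp only [mem_cluster]
  by_cases hx : x = v
  · subst hx
    constructor
    · intro h
      exact absurd ((conn_to_leaf_iff hf (by simp)).1 h) hsy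
    · intro h
      exact absurd (conn_leaf_closed hf hleaf hvy (by simp) (conn_symm h)) hs
  · exact conn_update_true_iff_update_false hf hleaf hvy hs hx

end LeafFacts

section Algebra

variable {R : Type*} [CommRing R] [LinearOrder R] [IsStrictOrderedRing R]

/-- Mixture algebra for the unmarked pendant: the inequality `a·q² ≤ g·B` is linear in `(a, g)`. -/
lemma psi_mix_algebra {q B w a0 g0 a1 g1 : R} (hw : 0 ≤ w) (hw1 : w ≤ 1)
    (h0 : a0 * q * q ≤ g0 * B) (h1 : a1 * q * q ≤ g1 * B) :
    (w * a1 + (1 - w) * a0) * q * q ≤ (w * g1 + (1 - w) * g0) * B := by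
  have e1 := mul_le_mul_of_nonneg_left h1 hw
  have e0 := mul_le_mul_of_nonneg_left h0 (sub_nonneg.2 hw1)
  nlinarith [e1, e0]

/-- Algebra for the pendant mark: the `o`-masses are `w` times the `y`-masses, `Ug` mixes `g0 ≤ g1`,
and the bracket `B` is nonnegative. -/
lemma psi_mark_algebra {q aH oL oLH oHH oH w a g0 g1 : R} (hw : 0 ≤ w)
    (hB : 0 ≤ (q - aH) * oL + q * (oLH + oHH) - aH * oH) (hg : g0 ≤ g1)
    (h : a * q * q ≤ g0 * ((q - aH) * oL + q * (oLH + oHH) - aH * oH)) :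
    (w * a) * q * q ≤ (w * g1 + (1 - w) * g0) *
      ((q - aH) * (w * oL) + q * (w * oLH + w * oHH) - aH * (w * oH)) := by
  have e1 := mul_le_mul_of_nonneg_left h hw
  have e2 : 0 ≤ w * w * (g1 - g0) * ((q - aH) * oL + q * (oLH + oHH) - aH * oH) :=
    mul_nonneg (mul_nonneg (mul_nonneg hw hw) (sub_nonneg.2 hg)) hB
  nlinarith [e1, e2]

/-- Algebra for the pendant conditioning vertex: the masses containing `{u ∈ C_s}` are `w` times
their contracted values; the two regimes of the covariance sign. -/
lemma psi_cond_algebra {q w a g oL oH aH oLH oHH : R} (hw : 0 ≤ w) (hw1 : w ≤ 1) (hg : 0 ≤ g)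
    (hq : 0 ≤ q) (hcross : a * q ≤ g * oL)
    (h : a * q * q ≤ g * ((q - aH) * oL + q * (oLH + oHH) - aH * oH)) :
    (w * a) * q * q ≤ (w * g) * ((q - w * aH) * oL + q * (w * oLH + w * oHH) - (w * aH) * oH) := by
  rcases le_or_gt (q * (oLH + oHH)) (aH * (oL + oH)) with hD | hD
  · -- covariance regime ≤ 0: the hypothesis carries
    have e1 := mul_le_mul_of_nonneg_left h hw
    have e2 : 0 ≤ w * (1 - w) * g * (aH * (oL + oH) - q * (oLH + oHH)) :=
      mul_nonneg (mul_nonneg (mul_nonneg hw (sub_nonneg.2 hw1)) hg) (sub_nonneg.2 hD)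
    nlinarith [e1, e2]
  · -- covariance regime ≥ 0: the cross-cluster instance carries
    have e1 := mul_le_mul_of_nonneg_left (mul_le_mul_of_nonneg_right hcross hq) hw
    have e2 : 0 ≤ w * w * g * (q * (oLH + oHH) - aH * (oL + oH)) :=
      mul_nonneg (mul_nonneg (mul_nonneg hw hw) hg) (sub_nonneg.2 hD.le)
    nlinarith [e1, e2]

end Algebra

end Summit.Ventures.PercRepro2
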